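import Mathlib
import Literature.Computability.AlgebraicComplexity.StandardFamilies

/-!
# Sketch — crux-ideate round 1 (ideator 1) for `ValuativeGCT.HeadFlip` (stmt-ValiantsHypothesis-15535)

First-lemma signatures for the two idea cards (elaboration only; no proofs claimed):

* card `two-adic-splitting`  — §1: the 2-adic lift `twoAdicLift`, the divisibility
  `two_dvd_rowDupPer`, the characteristic-2 identifications, the transfer target
  `CharTwoPencilCertificate` and its implication to the `m`-free hypothesis `H` of the landed
  `fourRowPencilRank_of_pencilCertificate` (Theorems/ValuativeGCTValuativeFlipFourRowTransfer.lean).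
* card `jacobian-syzygy-flag` — §2: the top-of-flag count `eulerSyzygiesOnly` and the flag
  statement `MaxRankAlongFlag`.
-/

noncomputable section

namespace Summit.ValiantsHypothesis.ValiantsHypothesis.Cruxes.HeadFlip.IdeatorOne

open MvPolynomial Literature.Computability.AlgebraicComplexity
open scoped BigOperators

/-! ## §0 Notation: a four-variable integer pencil and its avatars over `ℤ`, `ℂ`, `ZMod 2` -/

/-- The pencil entry `M_{ij}(y) = Σ_t A_{ij,t} y_t` over `ℤ`. -/
def pz {n : ℕ} (A : Fin n × Fin n → Fin 4 → ℤ) (ij : Fin n × Fin n) : MvPolynomial (Fin 4) ℤ :=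
  ∑ t : Fin 4, A ij t • (X t : MvPolynomial (Fin 4) ℤ)

/-- The same pencil over `ℂ`. -/
def pc {n : ℕ} (A : Fin n × Fin n → Fin 4 → ℤ) (ij : Fin n × Fin n) : MvPolynomial (Fin 4) ℂ :=
  ∑ t : Fin 4, (A ij t : ℂ) • (X t : MvPolynomial (Fin 4) ℂ)

/-- The same pencil reduced mod 2. -/
def p2 {n : ℕ} (A : Fin n × Fin n → Fin 4 → ℤ) (ij : Fin n × Fin n) : MvPolynomial (Fin 4) (ZMod 2) :=
  ∑ t : Fin 4, (A ij t : ZMod 2) • (X t : MvPolynomial (Fin 4) (ZMod 2))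

/-- Four-row tangent generator `y_t · Per_{kj}(M(y))` over `ℤ` (`Per_{kj}` = restricted
sub-permanent = `∂_{kj} per_n` evaluated on the pencil). -/
def prodZ {n : ℕ} (A : Fin n × Fin n → Fin 4 → ℤ) (tc : Fin 4 × (Fin n × Fin n)) :
    MvPolynomial (Fin 4) ℤ :=
  X tc.1 * aeval (pz A) (pderiv tc.2 (perPoly (Fin n) ℤ))

/-- The same generator over `ℂ` — exactly the family whose span appears in the `m`-free
hypothesis `H` of `fourRowPencilRank_of_pencilCertificate`. -/
def prodC {n : ℕ} (A : Fin n × Fin n → Fin 4 → ℤ) (tc : Fin 4 × (Fin n × Fin n)) :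
    MvPolynomial (Fin 4) ℂ :=
  X tc.1 * aeval (pc A) (pderiv tc.2 (perPoly (Fin n) ℂ))

/-- ROW-DUPLICATED PERMANENT: `per(M(y) with row k := row i) = Σ_j M_{ij}(y)·Per_{kj}(M(y))`,
the image under the per-tangent map of det's universal (`gl_n`) syzygy `Σ_j M_{ij} Det_{kj} = 0`
(`i ≠ k`). It lies in the `ℤ`-span of the generators `prodZ`. -/
def rowDupPer {n : ℕ} (A : Fin n × Fin n → Fin 4 → ℤ) (p : {p : Fin n × Fin n // p.1 ≠ p.2}) :
    MvPolynomial (Fin 4) ℤ :=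
  ∑ j : Fin n, pz A (p.1.1, j) * aeval (pz A) (pderiv (p.1.2, j) (perPoly (Fin n) ℤ))

/-- COLUMN-DUPLICATED PERMANENT: `per(M(y) with column l := column j)`. -/
def colDupPer {n : ℕ} (A : Fin n × Fin n → Fin 4 → ℤ) (p : {p : Fin n × Fin n // p.1 ≠ p.2}) :
    MvPolynomial (Fin 4) ℤ :=
  ∑ i : Fin n, pz A (i, p.1.1) * aeval (pz A) (pderiv (i, p.1.2) (perPoly (Fin n) ℤ))

/-! ## §1 Card `two-adic-splitting` -/

/-- **First lemma (2-adic lift).**  If `hr p`, `hc p` are HALVES of the duplicated-row /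
duplicated-column permanents, then the complex rank of the four-row tangent family is at least
the `𝔽₂`-rank of the reduced AUGMENTED family {products} ∪ {halves}.  Proof sketch: the
duplicated permanents lie in the `ℤ`-span of the products; rescaling rows by `2` does not change
`ℚ`-rank; rank does not increase under reduction mod 2; `ℚ`-rank = `ℂ`-rank. -/
theorem twoAdicLift (n : ℕ) (A : Fin n × Fin n → Fin 4 → ℤ)
    (hr hc : {p : Fin n × Fin n // p.1 ≠ p.2} → MvPolynomial (Fin 4) ℤ)
    (hhr : ∀ p, 2 • hr p = rowDupPer A p) (hhc : ∀ p, 2 • hc p = colDupPer A p) :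
    Module.finrank (ZMod 2) ↥(Submodule.span (ZMod 2)
        (Set.range (fun tc : Fin 4 × (Fin n × Fin n) => map (Int.castRingHom (ZMod 2)) (prodZ A tc)) ∪
         Set.range (fun p => map (Int.castRingHom (ZMod 2)) (hr p)) ∪
         Set.range (fun p => map (Int.castRingHom (ZMod 2)) (hc p)))) ≤
      Module.finrank ℂ ↥(Submodule.span ℂ (Set.range (prodC A))) := by
  sorry

/-- **Divisibility.** A permanent with two equal rows is twice an integral form: pair `σ` with
`σ ∘ (i k)`; explicitly `per(M_{k←i}) = 2·Σ_{j<l} M_{ij} M_{il} Per_{ik;jl}(M)`. -/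
theorem two_dvd_rowDupPer (n : ℕ) (A : Fin n × Fin n → Fin 4 → ℤ)
    (p : {p : Fin n × Fin n // p.1 ≠ p.2}) : ∃ h : MvPolynomial (Fin 4) ℤ, 2 • h = rowDupPer A p := by
  sorry

/-- **Characteristic-2 identification of the det block.** Mod 2 the products are
`y_t · Det_{kj}(M̄(y))` — signed minors of the reduced pencil (`perPoly = detPoly` in char 2,
tree fact `perPoly_eq_detPoly_of_charP_two`). Their span has rank ≤ `2n²+2` (determinantal
quaternary `n`-ics; the PARITY CAP). -/
theorem map_prodZ_eq_det (n : ℕ) (A : Fin n × Fin n → Fin 4 → ℤ) (tc : Fin 4 × (Fin n × Fin n)) :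
    map (Int.castRingHom (ZMod 2)) (prodZ A tc) =
      X tc.1 * aeval (p2 A) (pderiv tc.2 (detPoly (Fin n) (ZMod 2))) := by
  sorry

/-- **Characteristic-2 identification of the supplement.** Mod 2 the half of the row-duplicated
permanent is the "divided-square Laplace form" `Σ_{j<l} M̄_{ij} M̄_{il} · ∂_{ij}∂_{kl} det`
(second partials of `det` = complementary `(n-2)`-minors, sign-free in char 2). -/
theorem map_half_rowDupPer (n : ℕ) (A : Fin n × Fin n → Fin 4 → ℤ)
    (p : {p : Fin n × Fin n // p.1 ≠ p.2}) (h : MvPolynomial (Fin 4) ℤ) (hh : 2 • h = rowDupPer A p) :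
    map (Int.castRingHom (ZMod 2)) h =
      ∑ j : Fin n, ∑ l : Fin n, if j < l then
        p2 A (p.1.1, j) * p2 A (p.1.1, l) *
          aeval (p2 A) (pderiv (p.1.1, j) (pderiv (p.1.2, l) (detPoly (Fin n) (ZMod 2))))
      else 0 := by
  sorry

/-- **Transfer target `C⁺` (char-2 pencil certificate, slope 6/5 to match the landed reduction).**
For all large `n` there is an INTEGER four-variable pencil with an invertible `4×4` coordinate
minor whose reduced augmented family {`y_t·Det_kj(M̄)`} ∪ {½·row-dup} ∪ {½·col-dup} has
`𝔽₂`-rank ≥ `2⌊6n/5⌋² + ⌊6n/5⌋ + 2`.  Numerics (this seat): for random 0/1 pencils the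
`𝔽₂`-rank is `(k-2)n²+2 + 2n²-2n = kn²-2n+2` = the full complex rank (k = 5: n = 5..9; k = 6:
n = 5,6,7; k = 4 dominant regime n ≤ 8 consistent). -/
def CharTwoPencilCertificate : Prop :=
  ∃ n₀ : ℕ, ∀ n ≥ n₀, ∃ (A : Fin n × Fin n → Fin 4 → ℤ) (c : Fin 4 → Fin n × Fin n)
    (hr hc : {p : Fin n × Fin n // p.1 ≠ p.2} → MvPolynomial (Fin 4) ℤ),
    IsUnit (Matrix.of fun t t' : Fin 4 => (A (c t') t : ℂ)) ∧
    (∀ p, 2 • hr p = rowDupPer A p) ∧ (∀ p, 2 • hc p = colDupPer A p) ∧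
    2 * (6 * n / 5) ^ 2 + 6 * n / 5 + 2 ≤
      Module.finrank (ZMod 2) ↥(Submodule.span (ZMod 2)
        (Set.range (fun tc : Fin 4 × (Fin n × Fin n) => map (Int.castRingHom (ZMod 2)) (prodZ A tc)) ∪
         Set.range (fun p => map (Int.castRingHom (ZMod 2)) (hr p)) ∪
         Set.range (fun p => map (Int.castRingHom (ZMod 2)) (hc p))))

/-- **`C⁺` ⇒ the `m`-free hypothesis `H`** of the landed `fourRowPencilRank_of_pencilCertificate`
(verbatim shape of `H`, with `M ij t := (A ij t : ℂ)`), hence `stub_fourRowPencilRank`, hence (with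
the three infrastructure stubs of line four-row-count) `HeadFlip`.  One line from `twoAdicLift`. -/
theorem pencilCertificate_of_charTwo (hC : CharTwoPencilCertificate) :
    ∃ n₀ : ℕ, ∀ n ≥ n₀, ∃ (M : Fin n × Fin n → Fin 4 → ℂ) (c : Fin 4 → Fin n × Fin n),
      IsUnit (Matrix.of fun t t' : Fin 4 => M (c t') t) ∧
      2 * (6 * n / 5) ^ 2 + 6 * n / 5 + 2 ≤
        Module.finrank ℂ ↥(Submodule.span ℂ (Set.range fun tc : Fin 4 × (Fin n × Fin n) =>
          (X tc.1 : MvPolynomial (Fin 4) ℂ) *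
            aeval (fun ij : Fin n × Fin n => ∑ t : Fin 4, M ij t • (X t : MvPolynomial (Fin 4) ℂ))
              (pderiv tc.2 (perPoly (Fin n) ℂ)))) := by
  obtain ⟨n₀, hn₀⟩ := hC
  refine ⟨n₀, fun n hn => ?_⟩
  obtain ⟨A, c, hr, hc, hunit, hhr, hhc, hrank⟩ := hn₀ n hn
  refine ⟨fun ij t => (A ij t : ℂ), c, hunit, ?_⟩
  have h := twoAdicLift n A hr hc hhr hhc
  have e : (Set.range fun tc : Fin 4 × (Fin n × Fin n) =>
          (X tc.1 : MvPolynomial (Fin 4) ℂ) *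
            aeval (fun ij : Fin n × Fin n => ∑ t : Fin 4, ((A ij t : ℂ)) • (X t : MvPolynomial (Fin 4) ℂ))
              (pderiv tc.2 (perPoly (Fin n) ℂ))) = Set.range (prodC A) := by
    rfl
  rw [e]
  exact hrank.trans h

/-- **The parity cap (barrier, quantitative form).** For EVERY four-variable pencil over a field of
characteristic 2 the tangent family of `det_n` (= `per_n` there) spans at most `2n²+2` dimensions
(`n ≥ 4`; dimension of the cone of determinantal quaternary `n`-ics, Beauville 2000: codim
`C(n-1,3)` in `Sym^n`).  Consequence: no characteristic-free certificate reaches `2(n+1)²+(n+1)+2`. -/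
theorem parityCap (K : Type) [Field K] [CharP K 2] (n : ℕ) (hn : 4 ≤ n)
    (M : Fin n × Fin n → Fin 4 → K) :
    Module.finrank K ↥(Submodule.span K (Set.range fun tc : Fin 4 × (Fin n × Fin n) =>
      (X tc.1 : MvPolynomial (Fin 4) K) *
        aeval (fun ij : Fin n × Fin n => ∑ t : Fin 4, M ij t • (X t : MvPolynomial (Fin 4) K))
          (pderiv tc.2 (perPoly (Fin n) K)))) ≤ 2 * n ^ 2 + 2 := by
  sorry

/-! ## §2 Card `jacobian-syzygy-flag` -/

/-- **First lemma (top of the flag, `k = n²`): Euler syzygies are the only linear syzygies among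
the sub-permanents.**  `dim span{x_a · ∂_b per_n} = n⁴ - (2n - 2)` for `n ≥ 3`: the `2n-1` row /
column Euler identities `Σ_j x_{ij} ∂_{ij} per = per = Σ_i x_{ij} ∂_{ij} per` span `2n-2`
independent linear relations and there are no others (the Lie algebra of `Stab(per_n)` in
`gl_{n²}` is the torus part, Marcus–May 1962 / Landsberg 2017 §6.6).  In-tree lower bound
`≥ n⁴ - n²`: B2 `ValuativeGCTValuativeFlipTangentRank`. -/
theorem eulerSyzygiesOnly (n : ℕ) (hn : 3 ≤ n) :
    Module.finrank ℂ ↥(Submodule.span ℂ (Set.range fun ab : (Fin n × Fin n) × (Fin n × Fin n) =>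
      (X ab.1 : MvPolynomial (Fin n × Fin n) ℂ) * pderiv ab.2 (perPoly (Fin n) ℂ))) =
      n ^ 4 - (2 * n - 2) := by
  sorry

/-- **MAXIMAL RANK ALONG A GENERIC FLAG** (`MRF n k`): restricting the sub-permanent Jacobian
system to SOME (equivalently a generic) `k`-plane creates no linear syzygies beyond Euler's,
except those forced by the ambient dimension:
`dim span{y_t · Per_ij(M(y))} = min (C(n+k-1, k-1)) (k·n² - 2n + 2)`.
Verified exactly (this seat + strategist): k = 4 (n ≤ 19), 5 (n = 4..9), 6 (4..7), 7, 8 (4, 5), 10 (5).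
The det analogue `(k-2)n² + 2` is Gulliksen–Negård (submaximal minors: Gorenstein, codim 4)
tensored with a generic regular sequence — which is why FOUR rows is the critical truncation. -/
def MaxRankAlongFlag (n k : ℕ) : Prop :=
  ∃ M : Fin n × Fin n → Fin k → ℂ,
    Module.finrank ℂ ↥(Submodule.span ℂ (Set.range fun tc : Fin k × (Fin n × Fin n) =>
      (X tc.1 : MvPolynomial (Fin k) ℂ) *
        aeval (fun ij : Fin n × Fin n => ∑ t : Fin k, M ij t • (X t : MvPolynomial (Fin k) ℂ))
          (pderiv tc.2 (perPoly (Fin n) ℂ)))) = min (Nat.choose (n + k - 1) (k - 1)) (k * n ^ 2 - 2 * n + 2)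

/-- **One flag step (colon criterion).** Passing from `k+1` to `k` variables along a generic
hyperplane loses exactly `n²` (the multiples of the cut form) plus the NEW linear syzygies
`((J_{k+1} : ℓ) / J_{k+1})_{n-1}`; `MRF n (k+1) ∧ (no new syzygy unless forced) → MRF n k`.
Stated here in its counting shadow: the rank drop from `k+1` to `k` variables is at most `n²`
whenever the `k`-variable ambient still has room. -/
def FlagStep (n k : ℕ) : Prop :=
  k * n ^ 2 - 2 * n + 2 ≤ Nat.choose (n + k - 1) (k - 1) → MaxRankAlongFlag n (k + 1) → MaxRankAlongFlag n k

/-- `MRF n 4` for all large `n` gives the `m`-free certificate `H` (with slope 6/5: `4n²-2n+2 ≥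
2⌊6n/5⌋²+⌊6n/5⌋+2` and `C(n+3,3) ≥ …` for `n ≥ 12`), modulo the invertible-minor side condition,
which a generic pencil satisfies. Bookkeeping target for the crux-plan stage. -/
def MRFGivesHead : Prop :=
  (∃ n₀ : ℕ, ∀ n ≥ n₀, MaxRankAlongFlag n 4) →
    ∃ n₀ : ℕ, ∀ n ≥ n₀, ∃ (M : Fin n × Fin n → Fin 4 → ℂ),
      2 * (6 * n / 5) ^ 2 + 6 * n / 5 + 2 ≤
        Module.finrank ℂ ↥(Submodule.span ℂ (Set.range fun tc : Fin 4 × (Fin n × Fin n) =>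
          (X tc.1 : MvPolynomial (Fin 4) ℂ) *
            aeval (fun ij : Fin n × Fin n => ∑ t : Fin 4, M ij t • (X t : MvPolynomial (Fin 4) ℂ))
              (pderiv tc.2 (perPoly (Fin n) ℂ))))

end Summit.ValiantsHypothesis.ValiantsHypothesis.Cruxes.HeadFlip.IdeatorOne
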